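import Summits.BirchSwinnertonDyer.BirchSwinnertonDyer.Theorems.KatoDescentPotSupersingularKatoFiniteLevelStrictUnramifiedCount
import HarnessLib

/-!
# Kato's (14.9.3) at finite level, part 14: `#H⁰(K_v, E[p^∞]) = #E(K_v)[p^∞]` (Galois descent for the `p`-primary torsion) and
# `#H¹_ur(K_v, E[p^∞]) = #E(K_v)[p^∞]` when the inertia invariants are finite — Kato's §14.8 summand as a count of POINTS
# (route `KatoDescentPotSupersingular` / `…Tame…`, crux M = stmt-BirchSwinnertonDyer-19196; route-free helper)

Seat `bsd-potss-rkm` g17 (prover; cell `bsd-potss`), item stmt-BirchSwinnertonDyer-19196 (`--supports … --as helper`; closes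
nothing).  HONEST FRAMING: BSD is not proved by any of this; nothing is booked; theorems only (no definition, no named fact).

* `pow_nsmul_eq_zero_of_coprime_mul` — if `(p^a·u) • x = 0`, `p ∤ u`, and `x` is `p`-power torsion then `p^a • x = 0`.
* **`natCard_invariants_primary_toLocal_eq_natCard_primaryComponent`** — for every finite place `v` of the number field `K`:
  `#(E[p^∞]|_{Γ_{K_v}})^{Γ_{K_v}} = #E(K_v)[p^∞]`, the latter being the `p`-primary component
  `AddCommGroup.primaryComponent ((W ⊗ K_v)(K_v)) p` of Mathlib's group of `K_v`-rational points — at the common level `p^a`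
  (`a = v_p [E(K_v) : U]`, `U` torsion-free of finite index, Silverman VII.6.3 — tree `exists_finiteIndex_torsionFree_adicCompletion`)
  both sides are the `Γ_{K_v}`-invariants of `E[p^a]` resp. `E(K_v)[p^a]`, identified by Galois descent (tree
  `invariantsTorsionEquivKerZSMul`).
* **`natCard_unramifiedSubgroup_primary_eq_natCard_primaryComponent`** — with finite `I_v`-fixed points:
  `#H¹_ur(K_v, E[p^∞]) = #E(K_v)[p^∞]` (part 13 + the above): the ORDER of Kato's §14.8 summand `H¹(𝔽_v, E[p^∞]^{I_v})` is the
  number of `K_v`-rational `p`-power torsion points (`= c_v^{(p)}·#Ẽ_ns(𝔽_v)[p^∞]`-type Néron data, not unfolded here).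

References: J. H. Silverman, *AEC* VII.6.3, VIII §1 [SilvermanAEC2009]; J. S. Milne, *ADT* I Lemma 2.9, Lemma 3.3 [MilneADT2006];
K. Kato, Astérisque 295 (2004) §14.8 [Kato2004Asterisque].
-/

-- the summit and its single problem are both named `BirchSwinnertonDyer` (registry layout D-0017)
set_option linter.dupNamespace false
set_option autoImplicit false

noncomputable section

open scoped Classical ContRepresentation NumberField
open Function Field NumberField IsDedekindDomain WeierstrassCurve
open Literature.NumberTheory.EllipticCurves Literature.NumberTheory.GaloisRepresentations
  Literature.NumberTheory.GaloisRepresentations.DiscreteGaloisModule Literature.NumberTheory.GaloisCohomology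
open Summit.BirchSwinnertonDyer.Rank1Residual.X11b.Levels Summit.BirchSwinnertonDyer.Rank1Residual.X11b.LocBridge

universe u

namespace Summit.BirchSwinnertonDyer.BirchSwinnertonDyer.Theorems.KatoFiniteLevelCount

/-! ## §1 Arithmetic helper -/

/-- If `(p^a · u) • x = 0` with `p ∤ u` and `x` is `p`-power torsion, then `p^a • x = 0` (`gcd(u, p^j) = 1`). [folklore] -/
theorem pow_nsmul_eq_zero_of_coprime_mul {G : Type*} [AddCommGroup G] {p : ℕ} (hp : p.Prime) {a u j : ℕ} (hu : ¬p ∣ u)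
    {x : G} (h : (p ^ a * u) • x = 0) (hj : p ^ j • x = 0) : p ^ a • x = 0 := by
  set z := p ^ a • x with hz
  have huz : u • z = 0 := by rw [hz, ← mul_smul, mul_comm]; exact h
  have hpz : p ^ j • z = 0 := by rw [hz, smul_comm, hj, smul_zero]
  have hcop : Nat.Coprime u (p ^ j) := (Nat.Coprime.pow_left j ((Nat.Prime.coprime_iff_not_dvd hp).2 hu)).symm
  have h1 : addOrderOf z ∣ 1 := by
    rw [← hcop]
    exact Nat.dvd_gcd (addOrderOf_dvd_iff_nsmul_eq_zero.2 huz) (addOrderOf_dvd_iff_nsmul_eq_zero.2 hpz)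
  exact AddMonoid.addOrderOf_eq_one_iff.1 (Nat.dvd_one.1 h1)

/-! ## §2 `#H⁰(K_v, E[p^∞]) = #E(K_v)[p^∞]` -/

section LocalH0

variable {K : Type u} [Field K] [NumberField K] (W : WeierstrassCurve K) [W.IsElliptic] (p : ℕ) [Fact p.Prime]

/-- **`#H⁰(K_v, E[p^∞]) = #E(K_v)[p^∞]`**: the `Γ_{K_v}`-invariants of `E[p^∞]|_{Γ_{K_v}}` and the `p`-primary component of
Mathlib's `(W ⊗ K_v)(K_v)` have the same cardinality — both are killed by `p^a`, `a = v_p [E(K_v) : U]` for a torsion-free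
finite-index `U ≤ E(K_v)` (Silverman VII.6.3), and at level `p^a` Galois descent `(E[p^a]|_{Γ_{K_v}})^{Γ_{K_v}} ≃ E(K_v)[p^a]`
(tree `invariantsTorsionEquivKerZSMul`) identifies them. [cite: SilvermanAEC2009, Prop. VII.6.3 and VIII.§1] [cite: MilneADT2006, I Lemma 3.3] -/
theorem natCard_invariants_primary_toLocal_eq_natCard_primaryComponent (v : HeightOneSpectrum (𝓞 K)) :
    Nat.card (GaloisRep.toLocal v (primaryGaloisModule W p)).toTopRep.ρ.invariants =
      Nat.card (AddCommGroup.primaryComponent (W.baseChange (v.adicCompletion K)).toAffine.Point p) := by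
  have hp : p.Prime := Fact.out
  haveI : CharZero (v.adicCompletion K) := charZero_adicCompletion v
  obtain ⟨U, hU, htf, -⟩ := W.exists_finiteIndex_torsionFree_adicCompletion v
  haveI := hU
  obtain ⟨a, u, hu, ht⟩ := Nat.exists_eq_pow_mul_and_not_dvd (AddSubgroup.FiniteIndex.index_ne_zero (H := U)) p hp.ne_one
  -- the index kills every rational torsion point
  have htors : ∀ (P : (W.baseChange (v.adicCompletion K)).toAffine.Point) (m : ℕ), m ≠ 0 → m • P = 0 → U.index • P = 0 :=
    fun P m hm hmP => htf m hm _ (U.nsmul_index_mem P) (by rw [smul_comm, hmP, smul_zero])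
  -- (i) `p^a` kills `E(K_v)[p^∞]`
  have hkill : ∀ P : (W.baseChange (v.adicCompletion K)).toAffine.Point, (∃ j : ℕ, p ^ j • P = 0) → p ^ a • P = 0 := by
    rintro P ⟨j, hj⟩
    exact pow_nsmul_eq_zero_of_coprime_mul hp hu (ht ▸ htors P (p ^ j) (pow_ne_zero j hp.ne_zero) hj) hj
  -- intertwining of `ι_j` with the local actions
  have hι : ∀ (j : ℕ) (σ : absoluteGaloisGroup (v.adicCompletion K)) (T : W.geomTorsion ((p ^ j : ℕ) : ℤ)),
      primaryInclusion W p j (GaloisRep.toLocal v (W.torsionGaloisModule ((p ^ j : ℕ) : ℤ)) σ T) =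
        GaloisRep.toLocal v (primaryGaloisModule W p) σ (primaryInclusion W p j T) := by
    intro j σ T
    have h := ((primaryInclusion W p j).restrictField (v.adicCompletion K)).isIntertwining σ T
    rwa [ContinuousRep.toContRepresentation_apply_apply, ContinuousRep.toContRepresentation_apply_apply,
      ContIntertwiningMap.restrictField_apply, ContIntertwiningMap.restrictField_apply] at h
  -- a fixed `ι_j y` has `y` fixed
  have hinv : ∀ (j : ℕ) (y : W.geomTorsion ((p ^ j : ℕ) : ℤ)),
      (∀ σ : absoluteGaloisGroup (v.adicCompletion K),
        GaloisRep.toLocal v (primaryGaloisModule W p) σ (primaryInclusion W p j y) = primaryInclusion W p j y) →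
      y ∈ (GaloisRep.restrictField (v.adicCompletion K) (W.torsionGaloisModule ((p ^ j : ℕ) : ℤ))).invariants := by
    intro j y hy
    rw [ContinuousRep.mem_invariants]
    intro σ
    apply primaryInclusion_injective W p j
    exact (hι j σ y).trans (hy σ)
  -- (ii) `p^a` kills every `Γ_{K_v}`-fixed point of `E[p^∞]`
  have hfix : ∀ x : W.geomPrimaryTorsion p,
      (∀ σ : absoluteGaloisGroup (v.adicCompletion K), GaloisRep.toLocal v (primaryGaloisModule W p) σ x = x) →
        p ^ a • x = 0 := by
    intro x hx
    obtain ⟨j, hj⟩ := (AddCommGroup.mem_primaryComponent).mp x.2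
    haveI : NeZero (p ^ j) := ⟨pow_ne_zero j hp.ne_zero⟩
    have hn : ((p ^ j : ℕ) : ℤ) ≠ 0 := by exact_mod_cast (NeZero.ne (p ^ j))
    have hxj : p ^ j • x = 0 := Subtype.ext (by rw [AddSubmonoidClass.coe_nsmul, hj, ZeroMemClass.coe_zero])
    obtain ⟨y, hy⟩ := exists_primaryInclusion_eq_of_nsmul_eq_zero W p j x hxj
    have hyinv := hinv j y (by rw [hy]; exact hx)
    set P := W.invariantsTorsionEquivKerZSMul (v.adicCompletion K) hn ⟨y, hyinv⟩ with hP
    have htP : U.index • (P : (W.baseChange (v.adicCompletion K)).toAffine.Point) = 0 := by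
      refine htors _ (p ^ j) (NeZero.ne _) ?_
      have hPn : ((p ^ j : ℕ) : ℤ) • (P : (W.baseChange (v.adicCompletion K)).toAffine.Point) = 0 := P.2
      rwa [natCast_zsmul] at hPn
    have hty : U.index • y = 0 := by
      have h1 : U.index • (⟨y, hyinv⟩ :
          (GaloisRep.restrictField (v.adicCompletion K) (W.torsionGaloisModule ((p ^ j : ℕ) : ℤ))).invariants) = 0 := by
        apply (W.invariantsTorsionEquivKerZSMul (v.adicCompletion K) hn).injective
        rw [map_nsmul, map_zero]
        exact Subtype.ext (by rw [AddSubmonoidClass.coe_nsmul, ZeroMemClass.coe_zero]; exact htP)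
      exact congrArg (fun z : (GaloisRep.restrictField (v.adicCompletion K)
        (W.torsionGaloisModule ((p ^ j : ℕ) : ℤ))).invariants => (z : W.geomTorsion ((p ^ j : ℕ) : ℤ))) h1
    have htx : U.index • x = 0 := by rw [← hy, ← map_nsmul, hty, map_zero]
    exact pow_nsmul_eq_zero_of_coprime_mul hp hu (ht ▸ htx) hxj
  -- (iii) the common level `n = p^a`
  haveI : NeZero (p ^ a) := ⟨pow_ne_zero a hp.ne_zero⟩
  have hn : ((p ^ a : ℕ) : ℤ) ≠ 0 := by exact_mod_cast (NeZero.ne (p ^ a))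
  -- `(E[p^a]|Γ_v)^{Γ_v} ≃ (E[p^∞]|Γ_v)^{Γ_v}` via `ι_a`
  have e1 : (GaloisRep.restrictField (v.adicCompletion K) (W.torsionGaloisModule ((p ^ a : ℕ) : ℤ))).invariants ≃
      (GaloisRep.toLocal v (primaryGaloisModule W p)).toTopRep.ρ.invariants := by
    refine Equiv.ofBijective
      (fun y => ⟨primaryInclusion W p a (y : W.geomTorsion ((p ^ a : ℕ) : ℤ)),
        (Representation.mem_invariants _ _).mpr fun σ =>
          (hι a σ y).symm.trans
            (congrArg (primaryInclusion W p a) ((ContinuousRep.mem_invariants _ _).mp y.2 σ))⟩)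
      ⟨fun y y' h => Subtype.ext (primaryInclusion_injective W p a (congrArg Subtype.val h)), fun x => ?_⟩
    have hx : ∀ σ : absoluteGaloisGroup (v.adicCompletion K),
        GaloisRep.toLocal v (primaryGaloisModule W p) σ (x : W.geomPrimaryTorsion p) = x :=
      (Representation.mem_invariants _ _).mp x.2
    obtain ⟨y, hy⟩ := exists_primaryInclusion_eq_of_nsmul_eq_zero W p a (x : W.geomPrimaryTorsion p) (hfix _ hx)
    exact ⟨⟨y, hinv a y (by rw [hy]; exact hx)⟩, Subtype.ext hy⟩
  -- `(E[p^a]|Γ_v)^{Γ_v} ≃ E(K_v)[p^a]` (Galois descent) and `E(K_v)[p^a] = E(K_v)[p^∞]`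
  have e3 : (zsmulAddGroupHom ((p ^ a : ℕ) : ℤ) :
        (W.baseChange (v.adicCompletion K)).toAffine.Point →+ _).ker ≃
      AddCommGroup.primaryComponent (W.baseChange (v.adicCompletion K)).toAffine.Point p :=
    Equiv.subtypeEquivRight fun P => by
      rw [AddMonoidHom.mem_ker, zsmulAddGroupHom_apply, natCast_zsmul, AddCommGroup.mem_primaryComponent]
      exact ⟨fun h => ⟨a, h⟩, hkill P⟩
  rw [← Nat.card_congr e1, Nat.card_congr (W.invariantsTorsionEquivKerZSMul (v.adicCompletion K) hn).toEquiv,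
    Nat.card_congr e3]

end LocalH0

/-! ## §3 `#H¹_ur(K_v, E[p^∞]) = #E(K_v)[p^∞]` -/

section Unramified

variable {K : Type} [Field K] [NumberField K] (W : WeierstrassCurve K) [W.IsElliptic] (p : ℕ) [Fact p.Prime]

/-- **`#H¹_ur(K_v, E[p^∞]) = #E(K_v)[p^∞]` whenever the `I_v`-fixed points of `E[p^∞]` form a finite set** — the order of
Kato's §14.8 summand `H¹(𝔽_v, E[p^∞]^{I_v})` as a count of `K_v`-rational `p`-power torsion points (part 13's `h¹ = h⁰` and
§2's Galois descent). [cite: Kato2004Asterisque, §14.8 (p. 238)] [cite: MilneADT2006, Ch. I, Lemma 2.9 and Lemma 3.3] -/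
theorem natCard_unramifiedSubgroup_primary_eq_natCard_primaryComponent (v : HeightOneSpectrum (𝓞 K))
    (hfin : Set.Finite {x : W.geomPrimaryTorsion p |
      ∀ τ ∈ absInertia (v.adicCompletion K), GaloisRep.toLocal v (primaryGaloisModule W p) τ x = x}) :
    Nat.card (unramifiedSubgroup (GaloisRep.toLocal v (primaryGaloisModule W p)) 1) =
      Nat.card (AddCommGroup.primaryComponent (W.baseChange (v.adicCompletion K)).toAffine.Point p) := by
  rw [natCard_unramifiedSubgroup_primary_eq_natCard_invariants W p v hfin,
    natCard_invariants_primary_toLocal_eq_natCard_primaryComponent W p v]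

end Unramified

end Summit.BirchSwinnertonDyer.BirchSwinnertonDyer.Theorems.KatoFiniteLevelCount

end
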